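import Summits.CriticalPhenomena.PercolationContinuityZ3.Theorems.PercNearOneGluingNoHeavyLowerTailSahiTangentVertexFamilies

/-!
# `NoHeavyLowerTail` (crux stmt-CriticalPhenomena-4575), Sahi programme: **THE CONTRACTION INEQUALITY FOR CYLINDERS AT EVERY ORDER** —
# `E_n(C(σ₁∪e),…,C(σ_m∪e),C(σ_{m+1}),…,C(σ_n)) ≥ p_e · E_n(C(σ₁),…,C(σ_n))` for every `n`, every cube, every product measure (Theorem V)

Support file (Sahi cell, seat `prim-sahi-p1`, generation 49; `--supports stmt-CriticalPhenomena-4575`).  Pure proofs, no definitions, no `sorry`,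
standard axioms.  Part 2 of the vertex-family files (part 1: `…SahiTangentVertexFamilies`).

THE RESULT (`vtxD_nonneg_and_supermult`, `vtxD_nonneg`, `vtxD_supermult`).  For EVERY `n`, every `q : ι → [0,1]`, every `s ∈ [0,1]` and every vertex family
`(b, σ)` (cylinders `σ_l`, the slots with `b l = true` multiplied by the coin `ε` of bias `s`):
  (P) `vtxD q s n b σ = E_n^{B_s⊗μ}(F) − s·E_n^{μ}(1_{C(σ_l)}) ≥ 0`;
  (S) for a top-only slot `j` and any `h`: `M(h)·vtxD(b,σ) ≤ vtxD(b, σ[j := h ∪ σ_j])` (`M(h) = ∏_{e∈h} q_e`).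
(P) is the single-coordinate CONTRACTION INEQUALITY for plain cylinder families at every order (the coin being one more coordinate of the cube), and — through
the erasure/interpolation reduction of the order-4 files — the vertex form of the all-orders contraction inequality for cylinder PAIRS (memo §A2, §A6).
Orders 3 and 4 were the theorems of generations 48 and 49 (`sahiE_three_coin_cylinders_ge`, `sahiE_four_coin_cylinders_ge`).

THE PROOF (memo FROM-prim-sahi-p1-gen49-PRINCIPAL-BOTTOM-TANGENT §A6): induction on `n`, both claims together.  With a top-only slot moved to position `0`
(`vtxD_comp_perm`), the Lieb–Sahi recursion (`vtxD_succ_succ`) reads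
`vtxD(b,σ) = Σ_i vtxD(merge 0 into i+1) − s·M(σ₀)·vtxD(tail) + s(1−s)·M(σ₀)·E_{n+1}(tail cylinders)`;
the merged families are vertex families one size down, so (P) for them and Sahi's theorem for the tail cylinders leave only the negative term, which is paid by ONE merge
term through (S) one size down (`vtxD(tail[σ_{i₀} := σ₀ ∪ σ_{i₀}]) ≥ M(σ₀)·vtxD(tail)`); if the tail has no top-only slot the last two terms cancel exactly.  For (S)
the same recursion is compared for `σ` and `σ[0 := h ∪ σ₀]`: the merge terms by (S) one size down, the coin/cylinder term by `M(h∪σ₀) ≥ M(h)M(σ₀)`, and the deficit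
`s(M(h∪σ₀) − M(h)M(σ₀))·vtxD(tail)` of the negative term by the REFINED supermultiplicativity `Ψ(g∪u∪v) − M(g)Ψ(u∪v) ≥ (M(g∪u) − M(g)M(u))Ψ(v)`, which follows
from (S) applied twice (`supermult_refined`: `g' = g ∖ u`, `M(g∪u) = M(g')M(u)`, `M(g') ≥ M(g)`). [this work]
-/

namespace Summit.CriticalPhenomena.PercolationContinuityZ3.Theorems.SahiTangentCyl

open Finset Function Literature.Combinatorics.Sahi2008
open Literature.Probability.Percolation.DecisionTree (ind)
open scoped BigOperators

noncomputable section

variable {ι : Type*} [DecidableEq ι]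

/-- **Refined supermultiplicativity from plain supermultiplicativity** (the lemma "(S) twice ⟹ (S')"): if `M(g)·Ψ(x) ≤ Ψ(g ∪ x)` for all `g, x`, then
`Ψ(g ∪ u ∪ v) − M(g)Ψ(u ∪ v) ≥ (M(g ∪ u) − M(g)M(u))·Ψ(v)` (`M = cylMass p`, `0 ≤ p ≤ 1`). [this work] -/
theorem supermult_refined {p : ι → ℝ} (hp0 : ∀ e, 0 ≤ p e) (hp1 : ∀ e, p e ≤ 1) {Ψ : Finset ι → ℝ}
    (hS : ∀ g x : Finset ι, cylMass p g * Ψ x ≤ Ψ (g ∪ x)) (g u v : Finset ι) :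
    (cylMass p (g ∪ u) - cylMass p g * cylMass p u) * Ψ v ≤ Ψ (g ∪ u ∪ v) - cylMass p g * Ψ (u ∪ v) := by
  have e1 : g ∪ u ∪ v = (g \ u) ∪ (u ∪ v) := by rw [← Finset.union_assoc, Finset.sdiff_union_self_eq_union]
  have e2 : cylMass p (g ∪ u) = cylMass p (g \ u) * cylMass p u := by
    rw [← Finset.sdiff_union_self_eq_union, cylMass_union_of_disjoint Finset.sdiff_disjoint]
  have e3 : cylMass p g ≤ cylMass p (g \ u) := cylMass_anti hp0 hp1 Finset.sdiff_subset
  have h1 := hS (g \ u) (u ∪ v)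
  have h2 := hS u v
  rw [e1, e2]
  nlinarith [mul_le_mul_of_nonneg_left h2 (sub_nonneg.2 e3), h1]

variable [Fintype ι]

omit [DecidableEq ι] in
/-- `n = 0`: the defect vanishes. [this work] -/
theorem vtxD_zero (q : ι → unitInterval) (s : ℝ) (b : Fin 0 → Bool) (σ : Fin 0 → Finset ι) : vtxD q s 0 b σ = 0 := by
  unfold vtxD; rw [sahiE_zero, sahiE_zero]; ring

omit [DecidableEq ι] in
/-- `n = 1`, top-only slot: the defect vanishes (`s·M(σ₀) − s·M(σ₀)`). [this work] -/
theorem vtxD_one_true (q : ι → unitInterval) (s : ℝ) (b : Fin 1 → Bool) (σ : Fin 1 → Finset ι) (hb : b 0 = true) : vtxD q s 1 b σ = 0 := by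
  unfold vtxD
  rw [sahiE_one_apply, sahiE_one_apply, hb, ex_vtxSlot_true, ex_ind_cyl']
  ring

omit [DecidableEq ι] in
/-- `n = 1`, plain slot: the defect is `(1−s)M(σ₀)`. [this work] -/
theorem vtxD_one_false (q : ι → unitInterval) (s : ℝ) (b : Fin 1 → Bool) (σ : Fin 1 → Finset ι) (hb : b 0 = false) :
    vtxD q s 1 b σ = (1 - s) * cylMass (fun e => (q e : ℝ)) (σ 0) := by
  unfold vtxD
  rw [sahiE_one_apply, sahiE_one_apply, hb, vtxSlot_false, SahiTangent.ex_coin_snd, ex_ind_cyl']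
  ring

/-- **THEOREM V** (both halves, by induction on the number of slots).  For every `n`, every vertex family `(b, σ)`, `q : ι → [0,1]`, `s ∈ [0,1]`:
(P) `0 ≤ vtxD q s n b σ`, and (S) for every top-only slot `j` and every `h`: `M(h)·vtxD(b,σ) ≤ vtxD(b, σ[j := h ∪ σ_j])`. [this work] -/
theorem vtxD_nonneg_and_supermult (q : ι → unitInterval) {s : ℝ} (hs0 : 0 ≤ s) (hs1 : s ≤ 1) :
    ∀ (n : ℕ) (b : Fin n → Bool) (σ : Fin n → Finset ι),
      0 ≤ vtxD q s n b σ ∧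
        ∀ j : Fin n, b j = true → ∀ h : Finset ι,
          cylMass (fun e => (q e : ℝ)) h * vtxD q s n b σ ≤ vtxD q s n b (update σ j (h ∪ σ j)) := by
  have hq0 : ∀ e, 0 ≤ ((q e : ℝ)) := fun e => (q e).2.1
  have hq1 : ∀ e, ((q e : ℝ)) ≤ 1 := fun e => (q e).2.2
  set p : ι → ℝ := fun e => (q e : ℝ) with hp
  intro n
  induction n with
  | zero =>
    intro b σ
    refine ⟨by rw [vtxD_zero], fun j => j.elim0⟩
  | succ n ih =>
    cases n with
    | zero =>
      -- one slot
      intro b σ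
      by_cases hb : b 0 = true
      · refine ⟨by rw [vtxD_one_true q s b σ hb], fun j hj h => ?_⟩
        have hj0 : j = 0 := Fin.ext (by have := j.2; omega)
        subst hj0
        rw [vtxD_one_true q s b σ hb, vtxD_one_true q s b _ hb, mul_zero]
      · have hb' : b 0 = false := by simpa using hb
        refine ⟨?_, fun j hj h => ?_⟩
        · rw [vtxD_one_false q s b σ hb']
          exact mul_nonneg (sub_nonneg.2 hs1) (cylMass_nonneg hq0 _)
        · have hj0 : j = 0 := Fin.ext (by have := j.2; omega)
          subst hj0
          rw [hb'] at hj; exact absurd hj (by decide)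
    | succ k =>
      -- `k + 2` slots; `ih` is the statement for `k + 1` slots.
      -- STEP 1: both claims for families whose slot `0` is top-only.
      have auxP : ∀ (b : Fin (k + 2) → Bool) (σ : Fin (k + 2) → Finset ι), b 0 = true → 0 ≤ vtxD q s (k + 2) b σ := by
        intro b σ hb0
        rw [vtxD_succ_succ q s b σ hb0]
        have hm0 : 0 ≤ cylMass p (σ 0) := cylMass_nonneg hq0 _
        have hE : 0 ≤ sahiE (bernoulliWeight q) (k + 1) (fun l (ω : Set ι) => ind {ω : Set ι | (Fin.tail σ l : Set ι) ⊆ ω} ω) :=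
          sahiE_cyl_nonneg q (Fin.tail σ)
        have hterms : ∀ i : Fin (k + 1), 0 ≤ vtxD q s (k + 1) (update (Fin.tail b) i true) (update (Fin.tail σ) i (σ 0 ∪ σ i.succ)) :=
          fun i => (ih _ _).1
        have hsum : 0 ≤ ∑ i : Fin (k + 1), vtxD q s (k + 1) (update (Fin.tail b) i true) (update (Fin.tail σ) i (σ 0 ∪ σ i.succ)) :=
          Finset.sum_nonneg fun i _ => hterms i
        have htail : 0 ≤ vtxD q s (k + 1) (Fin.tail b) (Fin.tail σ) := (ih _ _).1
        by_cases ht : ∃ i₀ : Fin (k + 1), Fin.tail b i₀ = true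
        · obtain ⟨i₀, hi₀⟩ := ht
          -- the merge term at `i₀` pays the negative term
          have hS := (ih (Fin.tail b) (Fin.tail σ)).2 i₀ hi₀ (σ 0)
          have eb : update (Fin.tail b) i₀ true = Fin.tail b := by rw [← hi₀, update_eq_self]
          have hge : cylMass p (σ 0) * vtxD q s (k + 1) (Fin.tail b) (Fin.tail σ)
              ≤ vtxD q s (k + 1) (update (Fin.tail b) i₀ true) (update (Fin.tail σ) i₀ (σ 0 ∪ σ i₀.succ)) := by
            rw [eb]; exact hS
          have hsingle : vtxD q s (k + 1) (update (Fin.tail b) i₀ true) (update (Fin.tail σ) i₀ (σ 0 ∪ σ i₀.succ))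
              ≤ ∑ i : Fin (k + 1), vtxD q s (k + 1) (update (Fin.tail b) i true) (update (Fin.tail σ) i (σ 0 ∪ σ i.succ)) :=
            Finset.single_le_sum (fun i _ => hterms i) (Finset.mem_univ i₀)
          nlinarith [mul_nonneg hs0 (mul_nonneg hm0 htail), mul_nonneg (sub_nonneg.2 hs1) (mul_nonneg hm0 htail),
            mul_nonneg (mul_nonneg hs0 (sub_nonneg.2 hs1)) (mul_nonneg hm0 hE)]
        · -- the tail is plain: the last two terms cancel
          have hplain : ∀ l, Fin.tail b l = false := fun l => by
            by_contra hc; exact ht ⟨l, by simpa using hc⟩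
          rw [vtxD_of_plain q s hplain]
          nlinarith [mul_nonneg (mul_nonneg hs0 (sub_nonneg.2 hs1)) (mul_nonneg hm0 hE)]
      have auxS : ∀ (b : Fin (k + 2) → Bool) (σ : Fin (k + 2) → Finset ι), b 0 = true → ∀ h : Finset ι,
          cylMass p h * vtxD q s (k + 2) b σ ≤ vtxD q s (k + 2) b (update σ 0 (h ∪ σ 0)) := by
        intro b σ hb0 h
        have t1 : Fin.tail (update σ 0 (h ∪ σ 0)) = Fin.tail σ := Fin.tail_update_zero _ _
        have z1 : (update σ 0 (h ∪ σ 0)) 0 = h ∪ σ 0 := update_self _ _ _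
        have s1 : ∀ i : Fin (k + 1), (update σ 0 (h ∪ σ 0)) i.succ = σ i.succ := fun i => update_of_ne (Fin.succ_ne_zero i) _ _
        rw [vtxD_succ_succ q s b σ hb0, vtxD_succ_succ q s b (update σ 0 (h ∪ σ 0)) hb0, t1, z1]
        simp only [s1]
        have hmh : 0 ≤ cylMass p h := cylMass_nonneg hq0 _
        have hm0 : 0 ≤ cylMass p (σ 0) := cylMass_nonneg hq0 _
        have hmu : cylMass p h * cylMass p (σ 0) ≤ cylMass p (h ∪ σ 0) := cylMass_mul_le_union hq0 hq1 _ _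
        have hE : 0 ≤ sahiE (bernoulliWeight q) (k + 1) (fun l (ω : Set ι) => ind {ω : Set ι | (Fin.tail σ l : Set ι) ⊆ ω} ω) :=
          sahiE_cyl_nonneg q (Fin.tail σ)
        have htail : 0 ≤ vtxD q s (k + 1) (Fin.tail b) (Fin.tail σ) := (ih _ _).1
        -- every merge term is supermultiplicative (slot `i` of the merged family is top-only)
        have hmerge : ∀ i : Fin (k + 1), cylMass p h * vtxD q s (k + 1) (update (Fin.tail b) i true) (update (Fin.tail σ) i (σ 0 ∪ σ i.succ))
            ≤ vtxD q s (k + 1) (update (Fin.tail b) i true) (update (Fin.tail σ) i (h ∪ σ 0 ∪ σ i.succ)) := by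
          intro i
          have h2 := (ih (update (Fin.tail b) i true) (update (Fin.tail σ) i (σ 0 ∪ σ i.succ))).2 i (by rw [update_self]) h
          rw [update_self, update_idem, ← Finset.union_assoc] at h2
          exact h2
        have hsum : cylMass p h * ∑ i : Fin (k + 1), vtxD q s (k + 1) (update (Fin.tail b) i true) (update (Fin.tail σ) i (σ 0 ∪ σ i.succ))
            ≤ ∑ i : Fin (k + 1), vtxD q s (k + 1) (update (Fin.tail b) i true) (update (Fin.tail σ) i (h ∪ σ 0 ∪ σ i.succ)) := by
          rw [Finset.mul_sum]; exact Finset.sum_le_sum fun i _ => hmerge i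
        by_cases ht : ∃ i₀ : Fin (k + 1), Fin.tail b i₀ = true
        · obtain ⟨i₀, hi₀⟩ := ht
          -- Ψ(x) := vtxD(tail b, tail σ[i₀ := x]) is supermultiplicative by `ih`, hence refined-supermultiplicative
          have hΨ : ∀ g x : Finset ι, cylMass p g * vtxD q s (k + 1) (Fin.tail b) (update (Fin.tail σ) i₀ x)
              ≤ vtxD q s (k + 1) (Fin.tail b) (update (Fin.tail σ) i₀ (g ∪ x)) := by
            intro g x
            have h2 := (ih (Fin.tail b) (update (Fin.tail σ) i₀ x)).2 i₀ hi₀ g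
            rw [update_self, update_idem] at h2
            exact h2
          have href := supermult_refined (Ψ := fun x => vtxD q s (k + 1) (Fin.tail b) (update (Fin.tail σ) i₀ x)) hq0 hq1 hΨ h (σ 0) (σ i₀.succ)
          have eb : update (Fin.tail b) i₀ true = Fin.tail b := by rw [← hi₀, update_eq_self]
          have ev : update (Fin.tail σ) i₀ (σ i₀.succ) = Fin.tail σ := by
            have : σ i₀.succ = Fin.tail σ i₀ := rfl
            rw [this, update_eq_self]
          simp only [ev] at href
          -- the sum minus `M(h)`·sum dominates its `i₀` term
          have hrest : vtxD q s (k + 1) (update (Fin.tail b) i₀ true) (update (Fin.tail σ) i₀ (h ∪ σ 0 ∪ σ i₀.succ))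
                - cylMass p h * vtxD q s (k + 1) (update (Fin.tail b) i₀ true) (update (Fin.tail σ) i₀ (σ 0 ∪ σ i₀.succ))
              ≤ (∑ i : Fin (k + 1), vtxD q s (k + 1) (update (Fin.tail b) i true) (update (Fin.tail σ) i (h ∪ σ 0 ∪ σ i.succ)))
                - cylMass p h * ∑ i : Fin (k + 1), vtxD q s (k + 1) (update (Fin.tail b) i true) (update (Fin.tail σ) i (σ 0 ∪ σ i.succ)) := by
            rw [Finset.mul_sum, ← Finset.sum_sub_distrib]
            exact Finset.single_le_sum (f := fun i => vtxD q s (k + 1) (update (Fin.tail b) i true) (update (Fin.tail σ) i (h ∪ σ 0 ∪ σ i.succ))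
              - cylMass p h * vtxD q s (k + 1) (update (Fin.tail b) i true) (update (Fin.tail σ) i (σ 0 ∪ σ i.succ)))
              (fun i _ => sub_nonneg.2 (hmerge i)) (Finset.mem_univ i₀)
          rw [eb] at hrest
          nlinarith [hrest, href, mul_nonneg hs0 (mul_nonneg (sub_nonneg.2 hmu) htail),
            mul_nonneg (sub_nonneg.2 hs1) (mul_nonneg (sub_nonneg.2 hmu) htail),
            mul_nonneg (mul_nonneg hs0 (sub_nonneg.2 hs1)) (mul_nonneg (sub_nonneg.2 hmu) hE), hsum]
        · have hplain : ∀ l, Fin.tail b l = false := fun l => by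
            by_contra hc; exact ht ⟨l, by simpa using hc⟩
          rw [vtxD_of_plain q s hplain]
          nlinarith [hsum, mul_nonneg (mul_nonneg hs0 (sub_nonneg.2 hs1)) (mul_nonneg (sub_nonneg.2 hmu) hE)]
      -- STEP 2: general families by moving a top-only slot to position `0`.
      intro b σ
      by_cases hex : ∃ a, b a = true
      · obtain ⟨a, ha⟩ := hex
        have hP : 0 ≤ vtxD q s (k + 2) b σ := by
          rw [← vtxD_comp_perm q s (Equiv.swap 0 a) b σ]
          exact auxP _ _ (by simp [ha])
        refine ⟨hP, fun j hj h => ?_⟩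
        set π : Equiv.Perm (Fin (k + 2)) := Equiv.swap 0 j with hπ
        have hb0 : (b ∘ π) 0 = true := by simp [hπ, hj]
        have e1 : vtxD q s (k + 2) b σ = vtxD q s (k + 2) (b ∘ π) (σ ∘ π) := (vtxD_comp_perm q s π b σ).symm
        have e2 : vtxD q s (k + 2) b (update σ j (h ∪ σ j)) = vtxD q s (k + 2) (b ∘ π) (update (σ ∘ π) 0 (h ∪ (σ ∘ π) 0)) := by
          rw [← vtxD_comp_perm q s π b (update σ j (h ∪ σ j)), update_comp_equiv]
          have : π.symm j = 0 := by rw [hπ, Equiv.symm_swap, Equiv.swap_apply_right]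
          rw [this]
          simp [hπ]
        rw [e1, e2]
        exact auxS _ _ hb0 h
      · have hplain : ∀ l, b l = false := fun l => by
          by_contra hc; exact hex ⟨l, by simpa using hc⟩
        exact ⟨vtxD_nonneg_of_plain q hs1 hplain σ, fun j hj h => by rw [hplain j] at hj; exact absurd hj (by decide)⟩

/-- **(P): THE CONTRACTION INEQUALITY FOR CYLINDERS AT EVERY ORDER.**  For every `n`, every `q`, every `s ∈ [0,1]` and every vertex family:
`s · E_n^{μ}(1_{C(σ_0)},…,1_{C(σ_{n−1})}) ≤ E_n^{B_s⊗μ}(F)`, i.e. `0 ≤ vtxD q s n b σ`. [this work] -/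
theorem vtxD_nonneg (q : ι → unitInterval) {s : ℝ} (hs0 : 0 ≤ s) (hs1 : s ≤ 1) {n : ℕ} (b : Fin n → Bool) (σ : Fin n → Finset ι) :
    0 ≤ vtxD q s n b σ :=
  (vtxD_nonneg_and_supermult q hs0 hs1 n b σ).1

/-- **(S): supermultiplicativity in a top-only slot.** [this work] -/
theorem vtxD_supermult (q : ι → unitInterval) {s : ℝ} (hs0 : 0 ≤ s) (hs1 : s ≤ 1) {n : ℕ} (b : Fin n → Bool) (σ : Fin n → Finset ι)
    {j : Fin n} (hj : b j = true) (h : Finset ι) :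
    cylMass (fun e => (q e : ℝ)) h * vtxD q s n b σ ≤ vtxD q s n b (update σ j (h ∪ σ j)) :=
  (vtxD_nonneg_and_supermult q hs0 hs1 n b σ).2 j hj h

end

end Summit.CriticalPhenomena.PercolationContinuityZ3.Theorems.SahiTangentCyl
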